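import Summits.HodgeConjecture.HodgeConjecture.Theses.PadicSemiregularLift
import Literature.AlgebraicGeometry.Motives.AbelianVarietyProjectiveChart
import Literature.AlgebraicGeometry.Motives.ComplexPointsManifold
import Literature.AlgebraicGeometry.HodgeTheory.HodgeModelExistence
import Literature.AlgebraicGeometry.HodgeTheory.LefschetzOneOne
import Literature.AlgebraicGeometry.HodgeTheory.HardLefschetzNFold
import Literature.AlgebraicGeometry.HodgeTheory.TopDegreeClasses

/-!
# `HodgeBeyondAnchors` (stmt-HodgeConjecture-14054): upper bound and where a counterexample must live

Route `PadicSemiregularLift` of `HodgeConjecture`, support item `HodgeBeyondAnchors`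
(complement-of-anchors form, 2026-08-15):
`∀ n X, IsSmoothProjective n X → (∀ A : AbelianVariety ℂ, A.dim = n → A.X ≠ X) →
(∀ m, ¬ IsFermatVariety n m X) → HodgeConjectureFor n X` — the Hodge conjecture for every smooth
projective complex `n`-fold that is neither the underlying variety of an `n`-dimensional abelian
variety nor a Fermat hypersurface. The planner files it as a typed PLACEHOLDER ("not to be attacked
as typed"); this file records, as unconditional Lean theorems (the conditional ones take the tree's
named facts as explicit hypotheses, nothing is assumed), exactly what the item is:

* `hodgeConjecture_iff_anchors_and_beyond`: the item is implied by the summit statement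
  `HodgeConjecture` (so it claims nothing STRONGER than the Hodge conjecture, and any kill of it kills
  the summit), and together with the two anchor items
  `HodgeAbelianVarieties`, `HodgeFermatVarieties` it is EXACTLY the summit — the typed output layer of
  the route partitions `HodgeConjecture` into three cases (smooth-projectivity of `A.X` being PROVED in
  the tree, `AbelianVariety.isSmoothProjective_holds`); `iff_hodgeConjecture_of_anchors`: granted the
  anchors, the item is equivalent to the summit;
* `mem_algebraicClasses_of_extreme`, `iff_middle`: unconditionally the extreme codimensions `p = 0`
  and `p ≥ n` are harmless on every smooth projective `n`-fold, so the item is its part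
  `1 ≤ p < n` (plus the anti-vacuity conjunct `Nonempty (HodgeModel n X)`);
* `iff_deepMiddle`: granting the tree's named facts `nonempty_hodgeModel` (Serre GAGA + de Rham +
  Hodge decomposition), `lefschetzOneOne_rational` (Lefschetz `(1,1)`) and
  `nonempty_hardLefschetzNFold` (hard Lefschetz), the item is its part `2 ≤ p`, `2p ≤ n`: a
  counterexample, if any, is a rational `(p,p)`-class with `2 ≤ p ≤ n/2` on a non-anchor `n`-fold,
  `n ≥ 4`;
* `of_dim_le_three`: the slice `n ≤ 3` of the item (curves, surfaces, threefolds that are not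
  anchors) holds from the tree's named fact `hodgeClasses_algebraic_of_dim_le_three`
  (Voisin II, proof of Prop. 10.26) and `nonempty_hodgeModel`.

What is deliberately NOT here: no proof or refutation of the item (it is the open Hodge conjecture
off the two anchor classes, Deligne 2000 §1), no non-vacuity witness of the binder (a smooth
projective non-anchor `X` such as a curve of genus `≥ 2` is not yet constructible with
`IsSmoothProjective` in the tree).

References: P. Deligne, *The Hodge conjecture*, Clay (2000), §1; C. Voisin, *Hodge Theory and
Complex Algebraic Geometry* I (2002) Thm. 6.25, Thm. 11.30, §11.3, and II (2003) §10.2.3;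
A. Hatcher, *Algebraic Topology* (2002), Thm. 3.26.
-/

set_option linter.dupNamespace false

noncomputable section

open CategoryTheory AlgebraicGeometry

namespace Summit.HodgeConjecture.HodgeConjecture.Theorems.HodgeBeyondAnchors

open Summit.HodgeConjecture.HodgeConjecture.Theses.PadicSemiregularLift
open Literature.AlgebraicGeometry Literature.AlgebraicGeometry.HodgeTheory
  Literature.AlgebraicGeometry.Motives Literature.AlgebraicTopology.SingularHomology

/-! ## Read-back and the upper bound: the item is the summit off the anchors -/

/-- READ-BACK of the item, symbol by symbol: for every smooth projective geometrically irreducible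
`n`-fold `X/ℂ` which is not the underlying `ℂ`-scheme of an `n`-dimensional abelian variety and not
a Fermat hypersurface `x₀ᵐ + ⋯ + x_{n+1}ᵐ = 0` for any `m`, (i) a Hodge model of `X` exists and
(ii) every rational class of Hodge type `(p,p)` in `H²ᵖ(X(ℂ); ℂ)` lies in
`algebraicClasses X p = Nᵖ H²ᵖ`. Definitional (`Iff.rfl`). [cite: Deligne2000, §1] -/
theorem hodgeBeyondAnchors_iff :
    HodgeBeyondAnchors ↔
      ∀ ⦃n : ℕ⦄ ⦃X : SchemeOver ℂ⦄, IsSmoothProjective n X →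
        (∀ A : AbelianVariety ℂ, A.dim = n → A.X ≠ X) → (∀ m : ℕ, ¬ IsFermatVariety n m X) →
          Nonempty (HodgeModel n X) ∧
            ∀ (p : ℕ) (c : singularCohomology ℂ ℂ (ComplexPoints X) (2 * p)),
              IsRationalClass c → IsOfHodgeType n X (2 * p) p p c → c ∈ algebraicClasses X p :=
  Iff.rfl

/-- **The typed output layer of the route is exactly the summit.** `HodgeConjecture` is equivalent
to the conjunction of the two anchor items and this item — in particular the summit IMPLIES the item
(upper bound: the item claims nothing stronger than the Hodge conjecture, and any kill of it kills the
summit). `→` restricts the summit to each class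
(on abelian varieties the smooth-projectivity guard is the tree's PROVED
`AbelianVariety.isSmoothProjective_holds`, Görtz–Wedhorn Prop. 27.174; on Fermat varieties it is a
hypothesis of the item), `←` is the case split abelian anchor / Fermat anchor / the rest — formerly
the body of the route's deciding theorem `closes` with the Fermat anchor as a hypothesis; since the
crux-only repair of 2026-08-16 `closes` derives `HodgeFermatVarieties` inside from
`FermatAnchorAssembly` and the three lifting cruxes, so the old spelling `closes h₁ h₂ h₃` stopped
elaborating and the split is redone here (dependency-drift repair 2026-08-17, statement unchanged).
[cite: Deligne2000, §1] -/
theorem hodgeConjecture_iff_anchors_and_beyond :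
    _root_.HodgeConjecture ↔ HodgeAbelianVarieties ∧ HodgeFermatVarieties ∧ HodgeBeyondAnchors := by
  refine ⟨fun h ↦ ⟨fun A ↦ h (AbelianVariety.isSmoothProjective_holds (A := A)),
      fun _ _ _ _ hX ↦ h hX, fun _ _ hX _ _ ↦ h hX⟩, fun h ↦ ?_⟩
  obtain ⟨h₁, h₂, h₃⟩ := h
  intro n X hX
  by_cases hAb : ∃ A : AbelianVariety ℂ, A.dim = n ∧ A.X = X
  · obtain ⟨A, rfl, rfl⟩ := hAb
    exact h₁ A
  · by_cases hFe : ∃ m : ℕ, IsFermatVariety n m X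
    · obtain ⟨m, hm⟩ := hFe
      exact h₂ n m X hm hX
    · push Not at hAb hFe
      exact h₃ hX hAb hFe

/-- **Granted the two anchors, the item IS the Hodge conjecture** (so, as typed, it is the open
problem for all remaining varieties and carries no mechanism content of the route).
[cite: Deligne2000, §1] -/
theorem iff_hodgeConjecture_of_anchors (h₁ : HodgeAbelianVarieties) (h₂ : HodgeFermatVarieties) :
    HodgeBeyondAnchors ↔ _root_.HodgeConjecture :=
  ⟨fun h₃ ↦ hodgeConjecture_iff_anchors_and_beyond.2 ⟨h₁, h₂, h₃⟩, fun h _ _ hX _ _ ↦ h hX⟩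

/-! ## Where a counterexample must live: extreme codimensions are harmless -/

variable {n : ℕ} {X : SchemeOver ℂ}

/-- **Extreme codimensions (no Hodge-type or rationality hypothesis).** On a smooth projective
`n`-fold `X/ℂ`, every class of `H²ᵖ(X(ℂ); ℂ)` with `p = 0` or `n ≤ p` is algebraic: `p = 0` is
`algebraicClasses_zero` (`N⁰ = everything`); `p = n ≥ 1` is the top degree
(`mem_algebraicClasses_of_degree_top`: every class vanishes off a closed point); `p > n` is the zero
group (`ComplexPoints.subsingleton_singularCohomology_of_lt`, Hatcher Thm. 3.26(c) on the closed
`2n`-manifold `X(ℂ)`), which also covers `n = 0 < p`. All PROVED in the tree.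
[cite: HatcherAT2002, §3.3 Thm. 3.26(c)] -/
theorem mem_algebraicClasses_of_extreme (hX : IsSmoothProjective n X) {p : ℕ} (hp : p = 0 ∨ n ≤ p)
    (c : singularCohomology ℂ ℂ (ComplexPoints X) (2 * p)) : c ∈ algebraicClasses X p := by
  rcases Nat.eq_zero_or_pos p with rfl | hp0
  · exact hodgeConjectureFor_codim_zero c
  have hnp : n ≤ p := hp.resolve_left (by omega)
  rcases hnp.eq_or_lt with hnp' | hnp'
  · -- top degree `p = n ≥ 1`
    subst hnp'
    exact mem_algebraicClasses_of_degree_top hX hp0 c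
  · -- above the top degree the group vanishes
    haveI := ComplexPoints.subsingleton_singularCohomology_of_lt hX ℂ (k := 2 * p) (by omega)
    rw [Subsingleton.elim c 0]
    exact Submodule.zero_mem _

/-- **The item is equivalent to its middle-codimension part** `1 ≤ p < n` (plus the anti-vacuity
conjunct), unconditionally. A counterexample, if any, is a rational `(p,p)`-class with
`1 ≤ p ≤ n - 1` on a smooth projective non-anchor `n`-fold. [cite: VoisinHodgeII2003, §10.2.3 proof of Prop. 10.26] -/
theorem iff_middle :
    HodgeBeyondAnchors ↔
      ∀ ⦃n : ℕ⦄ ⦃X : SchemeOver ℂ⦄, IsSmoothProjective n X →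
        (∀ A : AbelianVariety ℂ, A.dim = n → A.X ≠ X) → (∀ m : ℕ, ¬ IsFermatVariety n m X) →
          Nonempty (HodgeModel n X) ∧
            ∀ p : ℕ, 1 ≤ p → p < n →
              ∀ c : singularCohomology ℂ ℂ (ComplexPoints X) (2 * p), IsRationalClass c →
                IsOfHodgeType n X (2 * p) p p c → c ∈ algebraicClasses X p := by
  refine ⟨fun h _ _ hX hA hF ↦ ⟨(h hX hA hF).1, fun p _ _ c hc hpp ↦ (h hX hA hF).2 p c hc hpp⟩,
    fun h n _ hX hA hF ↦ ⟨(h hX hA hF).1, ?_⟩⟩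
  intro p c hc hpp
  by_cases hmid : 1 ≤ p ∧ p < n
  · exact (h hX hA hF).2 p hmid.1 hmid.2 c hc hpp
  · exact mem_algebraicClasses_of_extreme hX (by omega) c

/-- **The cycle part on one smooth projective `X`, from its deep middle** (`2 ≤ p`, `2p ≤ n`),
granting Lefschetz `(1,1)` and hard Lefschetz (named facts of the tree): `p = 0`, `p ≥ n` by
`mem_algebraicClasses_of_extreme`; `p = 1` is `lefschetzOneOne_rational`; `2p > n` is reduced to
codimension `n - p < p` by `mem_algebraicClasses_of_lt_of_nonempty` (`L^{2p-n}` is a rational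
isomorphism of type `(2p-n, 2p-n)` preserving algebraicity); strong induction on `p` closes.
[cite: VoisinHodgeI2002, Thm. 6.25, Rem. 6.27, Thm. 11.30] -/
theorem cyclePart_of_deepMiddle (h11 : lefschetzOneOne_rational) (hHL : nonempty_hardLefschetzNFold n X)
    (hX : IsSmoothProjective n X)
    (h : ∀ p : ℕ, 2 ≤ p → 2 * p ≤ n →
      ∀ c : singularCohomology ℂ ℂ (ComplexPoints X) (2 * p), IsRationalClass c →
        IsOfHodgeType n X (2 * p) p p c → c ∈ algebraicClasses X p)
    (p : ℕ) (c : singularCohomology ℂ ℂ (ComplexPoints X) (2 * p)) (hc : IsRationalClass c)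
    (hpp : IsOfHodgeType n X (2 * p) p p c) : c ∈ algebraicClasses X p := by
  induction p using Nat.strong_induction_on with
  | _ p ih =>
    by_cases h0 : p = 0 ∨ n ≤ p
    · exact mem_algebraicClasses_of_extreme hX h0 c
    push Not at h0
    obtain ⟨hp0, hpn⟩ := h0
    by_cases h1 : p = 1
    · subst h1
      exact h11 hX c hc hpp
    by_cases hdeep : 2 * p ≤ n
    · exact h p (by omega) hdeep c hc hpp
    · -- `n < 2p`: hard Lefschetz reduces to codimension `n - p < p`
      refine mem_algebraicClasses_of_lt_of_nonempty hHL hX (by omega) ?_ c hc hpp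
      intro c' hc' hpp'
      exact ih (n - p) (by omega) c' hc' hpp'

/-- **Granting Hodge models, Lefschetz `(1,1)` and hard Lefschetz (named facts of the tree), the item
reduces to its DEEP middle `2 ≤ p`, `2p ≤ n`; in particular a minimal counterexample lives on a
non-anchor `n`-fold with `n ≥ 4`** (as for the Hodge conjecture itself: curves, surfaces and
threefolds are settled by `(1,1)` + `L : H² ≅ H⁴`). [cite: VoisinHodgeI2002, Thm. 6.25 and Thm. 11.30]
[cite: VoisinHodgeII2003, §10.2.3 proof of Prop. 10.26] -/
theorem iff_deepMiddle
    (hM : ∀ (n : ℕ) (X : SchemeOver ℂ), nonempty_hodgeModel n X)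
    (h11 : lefschetzOneOne_rational)
    (hHL : ∀ (n : ℕ) (X : SchemeOver ℂ), nonempty_hardLefschetzNFold n X) :
    HodgeBeyondAnchors ↔
      ∀ ⦃n : ℕ⦄ ⦃X : SchemeOver ℂ⦄, IsSmoothProjective n X →
        (∀ A : AbelianVariety ℂ, A.dim = n → A.X ≠ X) → (∀ m : ℕ, ¬ IsFermatVariety n m X) →
          ∀ p : ℕ, 2 ≤ p → 2 * p ≤ n →
            ∀ c : singularCohomology ℂ ℂ (ComplexPoints X) (2 * p), IsRationalClass c →
              IsOfHodgeType n X (2 * p) p p c → c ∈ algebraicClasses X p :=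
  ⟨fun h _ _ hX hA hF p _ _ c hc hpp ↦ (h hX hA hF).2 p c hc hpp,
    fun h _ _ hX hA hF ↦ ⟨hM _ _ hX,
      cyclePart_of_deepMiddle h11 (hHL _ _) hX (h hX hA hF)⟩⟩

/-- **The slice `n ≤ 3` of the item is settled from the tree's facts**: for a smooth projective
non-anchor `X` of dimension `n ≤ 3` (curves, surfaces, threefolds), `HodgeConjectureFor n X` follows
from `hodgeClasses_algebraic_of_dim_le_three` (Lefschetz `(1,1)` + `L : H² ≅ H⁴`, Voisin II proof
of Prop. 10.26) and `nonempty_hodgeModel` (the anti-vacuity conjunct); the anchor exclusions are not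
used. [cite: VoisinHodgeII2003, §10.2.3 proof of Prop. 10.26] -/
theorem of_dim_le_three (h3 : hodgeClasses_algebraic_of_dim_le_three)
    (hM : ∀ (n : ℕ) (X : SchemeOver ℂ), nonempty_hodgeModel n X) :
    ∀ ⦃n : ℕ⦄ ⦃X : SchemeOver ℂ⦄, IsSmoothProjective n X →
      (∀ A : AbelianVariety ℂ, A.dim = n → A.X ≠ X) → (∀ m : ℕ, ¬ IsFermatVariety n m X) →
        n ≤ 3 → HodgeConjectureFor n X :=
  fun _ _ hX _ _ hn ↦ hodgeConjectureFor_of_dim_le_three h3 (hM _ _) hn hX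

end Summit.HodgeConjecture.HodgeConjecture.Theorems.HodgeBeyondAnchors

end
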